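import Mathlib.Algebra.Homology.HomologySequenceLemmas
import Mathlib.RepresentationTheory.Homological.GroupCohomology.LongExactSequence
import Mathlib.RepresentationTheory.Homological.GroupCohomology.Shapiro
import Literature.Algebra.Homology.TwoCocycleExtension
import Literature.Algebra.Homology.GroupCohomologyFiniteIndexFiniteness
import HarnessLib

/-!
# Groups solving every finite embedding problem have `cd(Ĝ) ≤ 1` (Serre, finite level)

Topic `Algebra/Homology`; namespace `Literature.Algebra.Homology`.  Theorems only (no definition,
no named fact, no `sorry`).

A (discrete) group `Γ` *solves every finite embedding problem* if for all finite groups `P`, `E`,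
every homomorphism `π : Γ → P` and every surjection `ε : E ↠ P` there is `s : Γ → E` with
`ε ∘ s = π`.  Homomorphisms from `Γ` to finite groups are the same as continuous homomorphisms from
the profinite completion `Γ̂`, so this says that `Γ̂` has Serre's *propriété de relèvement* for all
extensions of finite groups, i.e. that `Γ̂` is a projective profinite group; by Serre,
*Cohomologie galoisienne*, I §3.4 Prop. 16 ((ii) ⟹ (i)) and I §5.9 Cor. 2 this is `cd(Γ̂) ≤ 1`:
`Hⁿ(Γ̂, M) = 0` for every `n ≥ 2` and every finite (equivalently, by I §3.1 Prop. 11, every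
discrete torsion) `Γ̂`-module `M`.  Since `Hⁿ(Γ̂, M) = lim_{→ U} Hⁿ(Γ̂/U, M)` over the open normal
subgroups acting trivially on `M` (I §2.2 Prop. 8, Cor. 1), i.e. the direct limit of `Hⁿ(Q, M)`
over the finite quotients `Γ ↠ Q` through which `M` is defined, the conclusion has the following
FINITE-LEVEL form, which is what is proved here, over Mathlib's `groupCohomology`, without
profinite groups:

* `exists_finiteQuotient_map_eq_zero_of_forall_lift` — if `Γ` solves every finite embedding
  problem, then for every homomorphism `π : Γ → Q` to a finite group, every representation `M` of
  `Q` with finitely many elements, every `n ≥ 2` and every `x ∈ Hⁿ(Q, M)` there is a finite quotient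
  `π' : Γ ↠ Q'` over `Q` (`φ ∘ π' = π`, `φ : Q' → Q`) in which `x` dies: `φ^* x = 0` in `Hⁿ(Q', φ^*M)`
  (`φ^*` = Mathlib `groupCohomology.map φ (𝟙 _) n`).

The proof is Serre's, read at the finite level.  Degree 2 (I §3.4, (ii) ⟹ (ii bis) ⟹ (i) via
I §2.3): write `x = [f]` with `f` a 2-cocycle and let `E_f ↠ Q` be the extension it defines
(`CocycleExtension f`, file `TwoCocycleExtension.lean`), a finite group; a solution `s : Γ → E_f`
of the embedding problem `(π, E_f ↠ Q)` has finite image `Q' := s(Γ) ≤ E_f`, over which `E_f`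
tautologically splits, so `φ^*[f] = 0` (`CocycleExtension.map_H2π_eq_zero_of_comp_eq`).  Degree
`n + 1 ≥ 3` (I §3.1, proof of Prop. 11: "on plonge `A` dans le module induit `M_G(A)`, et on
applique l'hypothèse de récurrence à `M_G(A)/A`"): embed `M ↪ Coind_1^Q M` (Mathlib `Rep.coind`, a
finite module with `Hⁿ⁺¹(Q, Coind_1^Q M) ≅ Hⁿ⁺¹(1, M) = 0` by Shapiro's lemma
`groupCohomology.coindIso`), so `x = δ y` with `y ∈ Hⁿ(Q, C)`, `C` the (finite) cokernel; kill `y`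
in some `Q'` by induction and use that the connecting homomorphism commutes with inflation along
`φ : Q' → Q` (`δ_comp_map_res`, from Mathlib `HomologicalComplex.HomologySequence.δ_naturality`).

* `not_forall_lift_of_forall_map_ne_zero` — contrapositive packaging: a class `x ∈ Hⁿ(Q, M)`,
  `n ≥ 2`, over a finite quotient of `Γ` that survives in every finite quotient of `Γ` over `Q`
  (a non-zero element of `Hⁿ(Γ̂, M)`) witnesses that `Γ` does not solve every finite embedding
  problem.  (Used with `n = 3`, `M = 𝔽₂` for closed aspherical 3-manifold groups in
  `Topology/FourManifolds/AsphericalThreeManifoldGroupNotProjectiveProofs.lean`.)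

* `not_forall_lift_of_map_ne_zero` — the same with the (stronger) hypothesis in the form goodness
  delivers it: `x ∈ Hⁿ(Q, M)` has non-zero inflation `π^* x ∈ Hⁿ(Γ, M)` to `Γ` itself
  (`π^* = π'^* ∘ φ^*`, `map_comp_id_id`).

## References

* J-P. Serre, *Cohomologie galoisienne*, LNM 5 (5e éd. 1994) = *Galois Cohomology* (1997): I §2.2
  Prop. 8 and Cor. 1 (`H^q(G, A) = lim H^q(G/U, A^U)`), I §2.3, I §3.1 Prop. 11 (proof: shift by
  the induced module), I §3.4 (lifting property; Prop. 16), I §5.9 Prop. 45 and Cor. 2 (projective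
  profinite groups).  [Serre1997]
* K. S. Brown, *Cohomology of Groups*, GTM 87 (1982), III (6.2) Shapiro, III §7 dimension
  shifting, III §8 (compatibility of the maps induced by group homomorphisms with long exact
  sequences), IV §3.  [Brown1982CohomologyGroups]

## Not here

The converse (`cd(Γ̂) ≤ 1` ⟹ all finite embedding problems are solvable, Serre I §5.9 Prop. 45 —
needs Sylow theory of profinite groups), profinite completions themselves, degree `n = 1` (false:
`H¹` of a free profinite group is not zero).
-/

noncomputable section

namespace Literature.Algebra.Homology

open CategoryTheory CategoryTheory.Limits groupCohomology

universe u v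

/-! ### The connecting homomorphism commutes with inflation along a group homomorphism -/

/-- **`δ` is natural in the group.**  For a short exact sequence `0 → X₁ → X₂ → X₃ → 0` of
representations of `Q` and a homomorphism `φ : Q' → Q`, the connecting homomorphisms of `X` and of
its restriction `φ^*X` to `Q'` satisfy `φ^* ∘ δ = δ ∘ φ^*`, where
`φ^* = groupCohomology.map φ (𝟙 _)` (Mathlib has the case `φ = id`, `groupCohomology.δ_naturality`;
the general case is the naturality of the snake-lemma `δ`,
`HomologicalComplex.HomologySequence.δ_naturality`, for the morphism of short exact sequences of
cochain complexes given by `groupCohomology.cochainsMap φ`).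
[cite: Brown1982CohomologyGroups, III §8 (maps induced by group homomorphisms are compatible with long exact sequences)] -/
theorem δ_comp_map_res {k Q Q' : Type u} [CommRing k] [Group Q] [Group Q'] (φ : Q' →* Q)
    {X : ShortComplex (Rep k Q)} (hX : X.ShortExact) (i j : ℕ) (hij : i + 1 = j) :
    δ hX i j hij ≫ map φ (𝟙 ((X.map (Rep.resFunctor φ)).X₁)) j =
      map φ (𝟙 ((X.map (Rep.resFunctor φ)).X₃)) i ≫ δ ((Rep.shortExact_res φ).2 hX) i j hij := by
  let Φ : X.map (cochainsFunctor k Q) ⟶ (X.map (Rep.resFunctor φ)).map (cochainsFunctor k Q') :=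
    { τ₁ := cochainsMap φ (𝟙 ((X.map (Rep.resFunctor φ)).X₁))
      τ₂ := cochainsMap φ (𝟙 ((X.map (Rep.resFunctor φ)).X₂))
      τ₃ := cochainsMap φ (𝟙 ((X.map (Rep.resFunctor φ)).X₃))
      comm₁₂ := rfl
      comm₂₃ := rfl }
  exact HomologicalComplex.HomologySequence.δ_naturality Φ (map_cochainsFunctor_shortExact hX)
    (map_cochainsFunctor_shortExact ((Rep.shortExact_res φ).2 hX)) i j hij

/-- Elementwise form of `δ_comp_map_res`: `φ^*(δ y) = δ(φ^* y)` for `y ∈ Hⁱ(Q, X₃)`.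
[cite: Brown1982CohomologyGroups, III §8 (maps induced by group homomorphisms are compatible with long exact sequences)] -/
theorem map_δ_apply {k Q Q' : Type u} [CommRing k] [Group Q] [Group Q'] (φ : Q' →* Q)
    {X : ShortComplex (Rep k Q)} (hX : X.ShortExact) (i j : ℕ) (hij : i + 1 = j)
    (y : groupCohomology X.X₃ i) :
    map φ (𝟙 ((X.map (Rep.resFunctor φ)).X₁)) j (δ hX i j hij y) =
      δ ((Rep.shortExact_res φ).2 hX) i j hij (map φ (𝟙 ((X.map (Rep.resFunctor φ)).X₃)) i y) := by
  rw [← CategoryTheory.comp_apply, ← CategoryTheory.comp_apply, δ_comp_map_res]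

/-! ### Serre's criterion, finite level -/

/-- **Solving all finite embedding problems kills `Hⁿ`, `n ≥ 2`, in finite quotients** (Serre,
*Cohomologie galoisienne*, I §3.4 Prop. 16 (ii) ⟹ (i), with I §3.1 Prop. 11 and I §2.2 Cor. 1 to
Prop. 8, read at the finite level).  Let `Γ` be a group such that every `π : Γ → P`, `P` finite,
lifts through every surjection of finite groups `E ↠ P`.  Then for every homomorphism `π : Γ → Q`
to a finite group, every `Q`-representation `M` with finitely many elements, every `n ≥ 2` and
every `x ∈ Hⁿ(Q, M)`, there are a finite group `Q'`, a SURJECTIVE `π' : Γ ↠ Q'` and `φ : Q' → Q`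
with `φ ∘ π' = π` such that `φ^* x = 0` in `Hⁿ(Q', φ^* M)`.  (Degree 2: `x = [f]`, solve the
embedding problem `E_f ↠ Q` and take for `Q'` the image of the solution,
`CocycleExtension.map_H2π_eq_zero_of_comp_eq`; degree `n + 1`: `x = δ y` along
`0 → M → Coind_1^Q M → C → 0`, Shapiro, induction, `δ_comp_map_res`.)
[cite: Serre1997, I §3.4 Prop. 16 with I §3.1 Prop. 11 (proof) and I §2.2 Prop. 8 Cor. 1] -/
theorem exists_finiteQuotient_map_eq_zero_of_forall_lift {Γ : Type v} [Group Γ]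
    (hlift : ∀ (P E : Type u) [Group P] [Finite P] [Group E] [Finite E] (π : Γ →* P)
      (ε : E →* P), Function.Surjective ε → ∃ s : Γ →* E, ε.comp s = π)
    (k : Type u) [CommRing k] {n : ℕ} (hn : 2 ≤ n) :
    ∀ (Q : Type u) [Group Q] [Finite Q] (M : Rep k Q) [Finite M] (π : Γ →* Q)
      (x : groupCohomology M n),
      ∃ (Q' : Type u) (_ : Group Q') (_ : Finite Q') (π' : Γ →* Q') (φ : Q' →* Q),
        Function.Surjective π' ∧ φ.comp π' = π ∧ map φ (𝟙 (Rep.res φ M)) n x = 0 := by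
  induction n, hn using Nat.le_induction with
  | base =>
    intro Q _ _ M _ π x
    induction x using H2_induction_on with
    | h f =>
      -- the embedding problem `E_f ↠ Q` and a solution `s`
      obtain ⟨s, hs⟩ := hlift Q (CocycleExtension f) π (CocycleExtension.rightHom f)
        (CocycleExtension.rightHom_surjective f)
      refine ⟨s.range, inferInstance, inferInstance, s.rangeRestrict,
        (CocycleExtension.rightHom f).comp s.range.subtype, s.rangeRestrict_surjective, ?_, ?_⟩
      · ext γ
        simp [← hs]
      · exact CocycleExtension.map_H2π_eq_zero_of_comp_eq f _ s.range.subtype rfl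
  | succ n hn ih =>
    intro Q _ _ M _ π x
    -- dimension shifting along `0 → M → Coind_1^Q Res_1 M → C → 0`
    let S : Subgroup Q := ⊥
    let B : Rep k Q := Rep.coind S.subtype (Rep.res S.subtype M)
    let ι : M ⟶ B := Rep.resCoindToHom S.subtype M (Rep.res S.subtype M) (𝟙 _)
    have hι : ∀ (a : M) (g : Q), (ι.hom a).1 g = M.ρ g a := fun a g => rfl
    have hιinj : Function.Injective ι.hom := by
      intro a b h
      have h1 := congr_arg (fun f : B => f.1 1) h
      simpa only [hι, map_one, Module.End.one_apply] using h1
    let W : Submodule k B := LinearMap.range ι.hom.toLinearMap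
    have hW : ∀ g, W ≤ W.comap (B.ρ g) := by
      rintro g _ ⟨a, rfl⟩
      exact ⟨M.ρ g a, Rep.hom_comm_apply ι g a⟩
    let X : ShortComplex (Rep k Q) :=
      { X₁ := M
        X₂ := B
        X₃ := Rep.quotient B W hW
        f := ι
        g := Rep.mkQ B W hW
        zero := by
          ext a
          exact (Submodule.Quotient.mk_eq_zero W).2 ⟨a, rfl⟩ }
    have hX : X.ShortExact :=
      { exact := (forget₂ (Rep k Q) (ModuleCat k)).reflects_exact_of_faithful _ <|
          (ShortComplex.moduleCat_exact_iff _).2 fun x hx => by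
            obtain ⟨a, ha⟩ := (Submodule.Quotient.mk_eq_zero W).1 hx
            exact ⟨a, ha⟩
        mono_f := (Rep.mono_iff_injective _).2 hιinj
        epi_g := (Rep.epi_iff_surjective _).2 (Submodule.mkQ_surjective _) }
    -- the terms are finite, the middle one is acyclic (Shapiro)
    haveI : Finite (Rep.res S.subtype M) := ‹Finite M›
    haveI hB : Finite B := finite_coind_of_finiteIndex S (Rep.res S.subtype M)
    haveI hC : Finite (Rep.quotient B W hW) :=
      Finite.of_surjective (Submodule.mkQ W) (Submodule.mkQ_surjective W)
    have hB0 : IsZero (groupCohomology B (n + 1)) :=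
      (isZero_groupCohomology_succ_of_subsingleton (Rep.res S.subtype M) n).of_iso
        (groupCohomology.coindIso (Rep.res S.subtype M) (n + 1))
    -- so `x = δ y`
    obtain ⟨y, rfl⟩ := (ModuleCat.epi_iff_surjective _).1 (epi_δ_of_isZero hX n hB0) x
    -- kill `y` in a finite quotient `Q'` (induction hypothesis), then `φ^* δ y = δ φ^* y = 0`
    obtain ⟨Q', _, _, π', φ, hπ', hφ, hy⟩ := ih Q (Rep.quotient B W hW) π y
    refine ⟨Q', inferInstance, inferInstance, π', φ, hπ', hφ, ?_⟩
    have hy' : map φ (𝟙 ((X.map (Rep.resFunctor φ)).X₃)) n y = 0 := hy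
    have key := map_δ_apply φ hX n (n + 1) rfl y
    rw [hy', map_zero] at key
    exact key

/-- **A class surviving in all finite quotients obstructs the lifting property** (contrapositive
of `exists_finiteQuotient_map_eq_zero_of_forall_lift`; Serre I §3.4 Prop. 16 with I §5.9 Cor. 2:
a profinite group with `cd > 1` is not projective).  If `π : Γ → Q` is a homomorphism to a finite
group and `x ∈ Hⁿ(Q, M)`, `n ≥ 2`, `M` finite, is such that `φ^* x ≠ 0` for every finite quotient
`π' : Γ ↠ Q'` over `Q` (`φ ∘ π' = π`) — i.e. `x` is non-zero in `Hⁿ(Γ̂, M) = lim Hⁿ(Q', M)` — then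
`Γ` does not solve every finite embedding problem.
[cite: Serre1997, I §3.4 Prop. 16 and I §5.9 Cor. 2] -/
theorem not_forall_lift_of_forall_map_ne_zero {Γ : Type v} [Group Γ] {k : Type u} [CommRing k]
    {n : ℕ} (hn : 2 ≤ n) {Q : Type u} [Group Q] [Finite Q] (M : Rep k Q) [Finite M] (π : Γ →* Q)
    (x : groupCohomology M n)
    (hx : ∀ (Q' : Type u) [Group Q'] [Finite Q'] (π' : Γ →* Q') (φ : Q' →* Q),
      Function.Surjective π' → φ.comp π' = π → map φ (𝟙 (Rep.res φ M)) n x ≠ 0) :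
    ¬ ∀ (P E : Type u) [Group P] [Finite P] [Group E] [Finite E] (π : Γ →* P) (ε : E →* P),
        Function.Surjective ε → ∃ s : Γ →* E, ε.comp s = π := by
  intro hlift
  obtain ⟨Q', _, _, π', φ, hπ', hφ, h0⟩ :=
    exists_finiteQuotient_map_eq_zero_of_forall_lift hlift k hn Q M π x
  exact hx Q' π' φ hπ' hφ h0

/-! ### The form in which goodness is used: a class with non-zero inflation to `Γ` -/

/-- Inflation is transitive on `Hⁿ`: `(φ ∘ π')^* = π'^* ∘ φ^*` (the case of identity coefficient
morphisms of Mathlib's `groupCohomology.map_comp`; `Rep.res (φ.comp π') M` and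
`Rep.res π' (Rep.res φ M)` are the same representation).
[cite: Brown1982CohomologyGroups, III §8 (functoriality of `H*(-, M)` in the group)] -/
theorem map_comp_id_id {k Γ Q Q' : Type u} [CommRing k] [Group Γ] [Group Q] [Group Q']
    (M : Rep k Q) (π' : Γ →* Q') (φ : Q' →* Q) (n : ℕ) :
    map (φ.comp π') (𝟙 (Rep.res (φ.comp π') M)) n =
      map φ (𝟙 (Rep.res φ M)) n ≫ map π' (𝟙 (Rep.res π' (Rep.res φ M))) n := by
  rw [← map_comp]
  rfl

/-- **A class with non-zero inflation to `Γ` obstructs the lifting property** — the form in which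
Serre's criterion is combined with GOODNESS (Serre I §2.6 Ex. 2; Aschenbrenner–Friedl–Wilton, proof
of Prop. 9.29: for a good group the inflation `Hⁿ(Γ̂, M) → Hⁿ(Γ, M)` is an isomorphism, so a
non-zero class of `Hⁿ(Γ, M)` comes from a finite quotient).  If `π : Γ → Q` is a homomorphism to a
finite group and `x ∈ Hⁿ(Q, M)`, `n ≥ 2`, `M` finite, has NON-ZERO INFLATION
`π^* x ∈ Hⁿ(Γ, π^* M)`, then `Γ` does not solve every finite embedding problem: otherwise some
finite quotient `π' : Γ ↠ Q'` over `Q` (`φ ∘ π' = π`) kills `x`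
(`exists_finiteQuotient_map_eq_zero_of_forall_lift`), and then `π^* x = π'^* (φ^* x) = 0`.
(Here `Γ`, `Q` and `k` live in one universe, as `groupCohomology.map π` requires; the lifting
property is accordingly quantified over finite groups of that universe.)
[cite: Serre1997, I §3.4 Prop. 16, I §5.9 Cor. 2, I §2.6 Ex. 1–2] -/
theorem not_forall_lift_of_map_ne_zero {Γ k Q : Type u} [Group Γ] [CommRing k] [Group Q]
    [Finite Q] {n : ℕ} (hn : 2 ≤ n) (M : Rep k Q) [Finite M] (π : Γ →* Q)
    (x : groupCohomology M n) (hx : map π (𝟙 (Rep.res π M)) n x ≠ 0) :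
    ¬ ∀ (P E : Type u) [Group P] [Finite P] [Group E] [Finite E] (ϖ : Γ →* P) (ε : E →* P),
        Function.Surjective ε → ∃ s : Γ →* E, ε.comp s = ϖ := by
  intro hlift
  obtain ⟨Q', _, _, π', φ, -, hφ, h0⟩ :=
    exists_finiteQuotient_map_eq_zero_of_forall_lift hlift k hn Q M π x
  subst hφ
  apply hx
  rw [map_comp_id_id, CategoryTheory.comp_apply, h0, map_zero]

end Literature.Algebra.Homology

end
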